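/-
Copyright: the b2b-balaban T⁴-continuum CRUX team, row NE7b leaf lineage `t4-ne7b-formalise-leaf-06` (gen 159). Project licence.
-/
import Summits.QuantumFields.BalabanUV.T4Continuum.Spine.NE7b.OneShotChartMixedNormTail
import Summits.QuantumFields.BalabanUV.T4Continuum.Spine.NE7b.OneShotChartACertificate
import Literature.MathematicalPhysics.QuantumFieldTheory.Balaban1983to89.B5Hk165L2Zd

/-!
# THE ONE-SHOT SECTION IN THE MIXED CURRENCY ON ALL OF `ℤ^d`: the operator `(HB)(p) = Σ′_y B(y)H(p,y)` on BOUNDED coarse data, its block-RMS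
# letter `RMS_{B(y″)}(HB) ≤ c_H·K_d(δ_H)·‖B‖_∞` BY NAME, and the certificate-plus-tail letter
# `RMS_{B(y″)}(HB) ≤ (√(λ(Σ_{y∈T}w_y)∕(n+1)^d) + τ)·‖B‖_∞` — the `T′ ↑ ℤ^d` limit of `…OneShotChartMixedNormTail`
# (row NE7b, node U5c; PRICING-NE7b v123 F727 (d) ∕ F733 (d): «the `ℤ^d` operator needs «window + tail» glued by Minkowski»; [folklore])

Cell `pub-balaban`, sub-cell `t4`, spine estimate NE7b (`T4WeightBudget.RelWeightBound`; the cell's OWN estimate — NOT PRINTED in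
[Bałaban 1983–89], NOT PROVED).  Crux-route work under `Spine/NE7b/` by leaf-06 (CRUX team (2), FREEZE (0) crux-prover clause).
NOTHING of Bałaban's is named as a Lean object, valued or asserted; no `T4Continuum/Support` leaf typed; no `def`; zero `sorry`.
Imports: `…Spine.NE7b.OneShotChartMixedNormTail` (OSCMNT: the finite-window glue, and through it OSCMN's certificate socket and
`B5Hk103ScalarZd`), `…Spine.NE7b.OneShotChartACertificate` (OSCAC: the per-row A-certificate sockets) and `Literature.….B5Hk165L2Zd` (the series
`HBZd n a B p = Σ′_y B(y)·H(p,y)` and the row summability `abs_kerH_row`).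

WHY.  OSCMN ∕ OSCMNT state the mixed-currency letters on FINITE coarse windows; the object the pricing desk's NC-NE7b-GAMMA-1 prices is the
operator on `ℤ^d` («QUANTITY `K_mix(M)²`», window `T_r` + tail).  For bounded coarse data the row series converges absolutely (every `d`,
`B5Hk165L2Zd.abs_kerH_row`), the finite-window sums converge to `(HB)(p)` along `T′ ↑ ℤ^d` (`atTop` on `Finset (ℤ^d)`), the block-RMS is a
continuous function of the finitely many values on the block, and OSCMNT's bounds are uniform in `T′ ⊇ T` — so they pass to the limit
(`le_of_tendsto`).  The tail enters FINITARILY: `τ` bounds `Σ_{y∈T′∖T}RMS_{B(y″)}(H(·,y))` for every finite `T′ ⊇ T` (equivalently the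
`tsum` over `y ∉ T`, the terms being nonnegative) — exactly what a certified `τ_r ≥ Σ_{y∉T_r}max_{p∈B(0)}|H(p,y)|` supplies
(`OneShotChartMixedNormTail.blockRMS_col_le_of_abs_le`).

WHAT IS PROVED (`a > 0`, `|B(y)| ≤ R` for all `y`; all [folklore]):
* §1 `tendsto_sum_kerH_mul` (`Σ_{y∈T′}H(p,y)B(y) → (HB)(p)` along `atTop`), `tendsto_blockRMS_HB`
  (`RMS_{B(y″)}(H_{T′}B) → RMS_{B(y″)}(HB)`).
* §2 **`blockRMS_HBZd_le_sup`** — THE MIXED LETTER ON `ℤ^d` BY NAME: `RMS_{B(y″)}(HB) ≤ c_H·K_d(δ_H)·R` (every `d`, every mesh; by value the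
  `10^{366}` family — SHAPE only).
* §3 **`blockRMS_HBZd_le_of_certificate_add_tail`** — certificate `(w, λ)` on a finite window `T` (OSCMN §5's `hdual` VERBATIM) + ONE finitary
  tail number `τ` ⇒ `RMS_{B(y″)}(HB) ≤ (√(λ(Σ_{y∈T}w_y)∕(n+1)^d) + τ)·R`; `blockRMS_HBZd_le_of_certificate_byName` (the tail by
  `kerH_blockRMS_le`, crude: `τ = c_H·K_d(δ_H)`).
* §4 **`blockRMS_HBZd_le_of_rowCertificate_add_tail`** — the A-CERTIFICATE on `ℤ^d` (OSCAC's per-ROW `ℓ¹` socket with the exact mean `Q′H = 1`):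
  window rows `≤ ρ`, finitary row tails `≤ τ`, `|B| ≤ R` ⇒ `RMS_{B(y″)}(HB) ≤ R·√(1 + (ρ + τ)²)`; **`blockRMS_HBZd_le_of_rowCertificateRMS_add_tail`**
  (RMS form, per-row `ρ(p)`, `τ(p)`: `≤ R·√(1 + (n+1)^{−d}Σ_{p∈B(y″)}(ρ(p) + τ(p))²)` — the desk's instrument 21 «Ũ1»).

HONEST: [folklore] limits; `(w, λ)` and `τ` DISPLAYED (zero kernel weight of any certificate on Bałaban's estimate, F733 (e)); `ℤ^d`, no torus
(the periodisation (CT-4) is the OWNER's (54)); nothing of (A3) ∕ NC-NE7b-α.  BY-NAME EFFECT ON THE WALL: NONE.  NE7b NOT PRINTED ∕ NOT PROVED;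
spine PROVED 0∕9; rung (B)+1 on a FINITE torus — NOT infinite volume, NOT the mass gap, NOT Clay.  HONEST DEPENDENCY: continuum YM on T⁴ ⇐
BetaPertH ∧ nine spine estimates (0∕9 proved); BetaPertH ⇐ (D1) ∧ (D4) ∧ CAP+tail; G-an2-4 gates asym, D1 and NE2∕3∕4.
-/

set_option autoImplicit false

namespace Summit.QuantumFields.BalabanUV.T4Continuum.NE7b.OneShotChartMixedNormZd

open Finset Filter Topology
open Literature.MathematicalPhysics.QuantumFieldTheory.Balaban1983to89
open B4Sect5Proof (latticeConst latticeSum_le latticeConst_nonneg)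
open B6QGQLower276 (X B)
open B5Hk103ScalarZd (kerH cH deltaH cH_pos deltaH_pos kerH_blockRMS_le)
open B5Hk165L2Zd (HBZd abs_kerH_row)
open OneShotChartMixedNorm (blockRMS_HB_le_sup)
open OneShotChartMixedNormTail (blockRMS_HB_le_of_certificate_add_tail)

variable {d : ℕ}

/-! ## §1. Finite windows exhaust `ℤ^d`: the partial sums and their block-RMS converge -/

/-- **THE ROW SERIES ON BOUNDED DATA, AS A LIMIT OF WINDOWS**: for `|B| ≤ R`, `Σ_{y∈T′}H(p,y)B(y) → (HB)(p) = Σ′_yB(y)H(p,y)` along the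
finite windows `T′ ↑ ℤ^d` (absolute convergence of the row, `B5Hk165L2Zd.abs_kerH_row`, every `d`). [folklore] -/
theorem tendsto_sum_kerH_mul (n : ℕ) {a : ℝ} (ha : 0 < a) {Bf : X d → ℝ} {R : ℝ} (hB : ∀ y, |Bf y| ≤ R) (p : X d) :
    Tendsto (fun T' : Finset (X d) => ∑ y ∈ T', kerH n a p y * Bf y) atTop (𝓝 (HBZd n a Bf p)) := by
  have hs : Summable fun y : X d => Bf y * kerH n a p y := by
    refine Summable.of_norm_bounded ((abs_kerH_row n ha p).1.mul_left R) fun y => ?_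
    rw [Real.norm_eq_abs, abs_mul]
    exact mul_le_mul_of_nonneg_right (hB y) (abs_nonneg _)
  have h := hs.hasSum
  simp only [HasSum, SummationFilter.unconditional_filter] at h
  have e : (fun T' : Finset (X d) => ∑ y ∈ T', kerH n a p y * Bf y) = fun T' => ∑ y ∈ T', Bf y * kerH n a p y := by
    funext T'; exact Finset.sum_congr rfl fun y _ => mul_comm _ _
  rw [e]
  exact h

/-- **THE BLOCK-RMS OF THE WINDOWS CONVERGES**: `RMS_{B(y″)}(H_{T′}B) → RMS_{B(y″)}(HB)` along `T′ ↑ ℤ^d` (finitely many sites on the block;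
`√` and the square are continuous). [folklore] -/
theorem tendsto_blockRMS_HB (n : ℕ) {a : ℝ} (ha : 0 < a) (y'' : X d) {Bf : X d → ℝ} {R : ℝ} (hB : ∀ y, |Bf y| ≤ R) :
    Tendsto (fun T' : Finset (X d) =>
        Real.sqrt ((((n : ℝ) + 1) ^ d)⁻¹ * ∑ p ∈ B n y'', (∑ y ∈ T', kerH n a p y * Bf y) ^ 2))
      atTop (𝓝 (Real.sqrt ((((n : ℝ) + 1) ^ d)⁻¹ * ∑ p ∈ B n y'', HBZd n a Bf p ^ 2))) := by
  refine Tendsto.sqrt (Tendsto.const_mul _ (tendsto_finsetSum _ fun p _ => ?_))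
  exact (tendsto_sum_kerH_mul n ha hB p).pow 2

/-! ## §2. The mixed letter on `ℤ^d` by name -/

/-- **THE MIXED LETTER `‖H_M‖_{ℓ^∞(ℤ^d) → ℓ^∞(blocks; RMS)} ≤ c_H(d,a)·K_d(δ_H(d,a))` ON ALL OF `ℤ^d`**: for `|B| ≤ R` and every block `y″`,
`√((n+1)^{−d}Σ_{p∈B(y″)}(HB)(p)²) ≤ c_H·K_d(δ_H)·R` — OSCMN §3 on every finite window, then the limit. By value the `10^{366}` family (SHAPE).
[folklore] -/
theorem blockRMS_HBZd_le_sup (n : ℕ) {a : ℝ} (ha : 0 < a) (y'' : X d) {Bf : X d → ℝ} {R : ℝ} (hB : ∀ y, |Bf y| ≤ R) :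
    Real.sqrt ((((n : ℝ) + 1) ^ d)⁻¹ * ∑ p ∈ B n y'', HBZd n a Bf p ^ 2) ≤ cH d a * latticeConst d (deltaH d a) * R := by
  have hR : 0 ≤ R := (abs_nonneg _).trans (hB 0)
  refine le_of_tendsto (tendsto_blockRMS_HB n ha y'' hB) (Filter.Eventually.of_forall fun T' => ?_)
  exact blockRMS_HB_le_sup n ha y'' T' Bf hR fun y _ => hB y

/-! ## §3. Certificate on a window + one tail number, on all of `ℤ^d` -/

/-- **THE CERTIFICATE-PLUS-TAIL LETTER ON `ℤ^d`**: a dual certificate `(w, λ)` on a finite window `T` (OSCMN §5's `hdual` VERBATIM), ONE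
finitary tail number `τ` (`Σ_{y∈T′∖T}RMS_{B(y″)}(H(·,y)) ≤ τ` for every finite `T′ ⊇ T` — e.g. a certified `Σ_{y∉T}max_{p∈B(y″)}|H(p,y)|` via
`OneShotChartMixedNormTail.blockRMS_col_le_of_abs_le`) and bounded data `|B| ≤ R` give
`RMS_{B(y″)}(HB) ≤ (√(λ(Σ_{y∈T}w_y)∕(n+1)^d) + τ)·R` for the operator on ALL of `ℤ^d` — OSCMNT's one-line substitution on every `T′ ⊇ T`,
then `T′ ↑ ℤ^d`. [folklore] -/
theorem blockRMS_HBZd_le_of_certificate_add_tail (n : ℕ) {a : ℝ} (ha : 0 < a) (y'' : X d) (T : Finset (X d))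
    (w : X d → ℝ) (lam : ℝ) (hw : ∀ y ∈ T, 0 < w y) (hlam : 0 ≤ lam)
    (hdual : ∀ v : X d → ℝ, ∑ y ∈ T, (∑ p ∈ B n y'', v p * kerH n a p y) ^ 2 / w y ≤ lam * ∑ p ∈ B n y'', v p ^ 2)
    {τ : ℝ} (htail : ∀ T' : Finset (X d), T ⊆ T' →
      ∑ y ∈ T' \ T, Real.sqrt ((((n : ℝ) + 1) ^ d)⁻¹ * ∑ p ∈ B n y'', kerH n a p y ^ 2) ≤ τ)
    {Bf : X d → ℝ} {R : ℝ} (hB : ∀ y, |Bf y| ≤ R) :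
    Real.sqrt ((((n : ℝ) + 1) ^ d)⁻¹ * ∑ p ∈ B n y'', HBZd n a Bf p ^ 2)
      ≤ (Real.sqrt (lam * (∑ y ∈ T, w y) / ((n : ℝ) + 1) ^ d) + τ) * R := by
  have hR : 0 ≤ R := (abs_nonneg _).trans (hB 0)
  refine le_of_tendsto (tendsto_blockRMS_HB n ha y'' hB) ?_
  filter_upwards [eventually_ge_atTop T] with T' hT'
  exact blockRMS_HB_le_of_certificate_add_tail n a y'' hT' w lam hw hlam hdual (htail T' hT') Bf hR fun y _ => hB y

/-- **THE SAME BY NAME** (crude tail): the finitary tail hypothesis is discharged by the tree's decay with `τ = c_H·K_d(δ_H)`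
(`Σ_{y∈T′∖T}RMS_{B(y″)}(H(·,y)) ≤ c_H·Σ_{y∈T′∖T}e^{−δ_H dist(y″,y)} ≤ c_H·K_d(δ_H)`, `kerH_blockRMS_le` + `latticeSum_le`) — the certificate
improves the window part only; SHAPE, the `10^{366}` family by value. [folklore] -/
theorem blockRMS_HBZd_le_of_certificate_byName (n : ℕ) {a : ℝ} (ha : 0 < a) (y'' : X d) (T : Finset (X d))
    (w : X d → ℝ) (lam : ℝ) (hw : ∀ y ∈ T, 0 < w y) (hlam : 0 ≤ lam)
    (hdual : ∀ v : X d → ℝ, ∑ y ∈ T, (∑ p ∈ B n y'', v p * kerH n a p y) ^ 2 / w y ≤ lam * ∑ p ∈ B n y'', v p ^ 2)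
    {Bf : X d → ℝ} {R : ℝ} (hB : ∀ y, |Bf y| ≤ R) :
    Real.sqrt ((((n : ℝ) + 1) ^ d)⁻¹ * ∑ p ∈ B n y'', HBZd n a Bf p ^ 2)
      ≤ (Real.sqrt (lam * (∑ y ∈ T, w y) / ((n : ℝ) + 1) ^ d) + cH d a * latticeConst d (deltaH d a)) * R := by
  refine blockRMS_HBZd_le_of_certificate_add_tail n ha y'' T w lam hw hlam hdual (fun T' _ => ?_) hB
  have hδ := deltaH_pos d ha
  calc ∑ y ∈ T' \ T, Real.sqrt ((((n : ℝ) + 1) ^ d)⁻¹ * ∑ p ∈ B n y'', kerH n a p y ^ 2)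
      ≤ ∑ y ∈ T' \ T, cH d a * Real.exp (-(deltaH d a * dist y'' y)) :=
        Finset.sum_le_sum fun y _ => kerH_blockRMS_le n ha y'' y
    _ = cH d a * ∑ y ∈ T' \ T, Real.exp (-(deltaH d a * dist y'' y)) := by rw [Finset.mul_sum]
    _ ≤ cH d a * latticeConst d (deltaH d a) :=
        mul_le_mul_of_nonneg_left (latticeSum_le d hδ (T' \ T) y'') (cH_pos d ha).le

/-! ## §4. The A-certificate on all of `ℤ^d` (`…OneShotChartACertificate`'s per-row sockets, `T′ ↑ ℤ^d`) -/

/-- **THE A-CERTIFICATE LETTER ON `ℤ^d`**: a finite window `T ∋ y″`, per-ROW window certificate `|H(p,y″) − 1| + Σ_{y∈T∖{y″}}|H(p,y)| ≤ ρ`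
and per-row FINITARY tail allowance `Σ_{y∈T′∖T}|H(p,y)| ≤ τ` for every finite `T′ ⊇ T` (both for `p ∈ B(y″)`; the tail is the `ℓ¹` row tail over
`y ∉ T`, nonnegative terms), bounded data `|B| ≤ R` ⇒ `RMS_{B(y″)}(HB) ≤ R·√(1 + (ρ + τ)²)` for the operator on ALL of `ℤ^d` — the exact mean
`Q′H = 1` carries the leading `1`, only the fluctuation is certified (`OneShotChartACertificate.blockRMS_HB_le_of_rowCertificate_add_tail` on every `T′ ⊇ T`,
then `le_of_tendsto`). [folklore] -/
theorem blockRMS_HBZd_le_of_rowCertificate_add_tail (n : ℕ) {a : ℝ} (ha : 0 < a) (y'' : X d) {T : Finset (X d)} (hy : y'' ∈ T)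
    {ρ τ : ℝ} (hrow : ∀ p ∈ B n y'', |kerH n a p y'' - 1| + ∑ y ∈ T.erase y'', |kerH n a p y| ≤ ρ)
    (htail : ∀ T' : Finset (X d), T ⊆ T' → ∀ p ∈ B n y'', ∑ y ∈ T' \ T, |kerH n a p y| ≤ τ)
    {Bf : X d → ℝ} {R : ℝ} (hB : ∀ y, |Bf y| ≤ R) :
    Real.sqrt ((((n : ℝ) + 1) ^ d)⁻¹ * ∑ p ∈ B n y'', HBZd n a Bf p ^ 2) ≤ R * Real.sqrt (1 + (ρ + τ) ^ 2) := by
  have hR : 0 ≤ R := (abs_nonneg _).trans (hB 0)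
  refine le_of_tendsto (tendsto_blockRMS_HB n ha y'' hB) ?_
  filter_upwards [eventually_ge_atTop T] with T' hT'
  exact OneShotChartACertificate.blockRMS_HB_le_of_rowCertificate_add_tail n ha y'' hT' hy hrow (htail T' hT') Bf hR
    fun y _ => hB y

/-- **THE A-CERTIFICATE LETTER ON `ℤ^d`, RMS FORM** (the desk's instrument 21 «Ũ1», v126 F754 (b)): per-row window bounds `ρ(p)` and per-row
FINITARY tail allowances `τ(p)` (`Σ_{y∈T′∖T}|H(p,y)| ≤ τ(p)` for every finite `T′ ⊇ T`), `|B| ≤ R` ⇒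
`RMS_{B(y″)}(HB) ≤ R·√(1 + (n+1)^{−d}Σ_{p∈B(y″)}(ρ(p) + τ(p))²)` for the operator on all of `ℤ^d`. [folklore] -/
theorem blockRMS_HBZd_le_of_rowCertificateRMS_add_tail (n : ℕ) {a : ℝ} (ha : 0 < a) (y'' : X d) {T : Finset (X d)} (hy : y'' ∈ T)
    (ρ τ : X d → ℝ) (hrow : ∀ p ∈ B n y'', |kerH n a p y'' - 1| + ∑ y ∈ T.erase y'', |kerH n a p y| ≤ ρ p)
    (htail : ∀ T' : Finset (X d), T ⊆ T' → ∀ p ∈ B n y'', ∑ y ∈ T' \ T, |kerH n a p y| ≤ τ p)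
    {Bf : X d → ℝ} {R : ℝ} (hB : ∀ y, |Bf y| ≤ R) :
    Real.sqrt ((((n : ℝ) + 1) ^ d)⁻¹ * ∑ p ∈ B n y'', HBZd n a Bf p ^ 2)
      ≤ R * Real.sqrt (1 + (((n : ℝ) + 1) ^ d)⁻¹ * ∑ p ∈ B n y'', (ρ p + τ p) ^ 2) := by
  have hR : 0 ≤ R := (abs_nonneg _).trans (hB 0)
  refine le_of_tendsto (tendsto_blockRMS_HB n ha y'' hB) ?_
  filter_upwards [eventually_ge_atTop T] with T' hT'
  exact OneShotChartACertificate.blockRMS_HB_le_of_rowCertificateRMS_add_tail n ha y'' hT' hy ρ τ hrow (htail T' hT') Bf hR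
    fun y _ => hB y

end Summit.QuantumFields.BalabanUV.T4Continuum.NE7b.OneShotChartMixedNormZd
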